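import Summits.HodgeConjecture.HodgeConjecture.Theorems.Ring2AbelianAllFermatLevelReduction
import Literature.AlgebraicGeometry.HodgeTheory.FermatEigenspaceNonvanishing
import Literature.AlgebraicGeometry.HodgeTheory.FermatEigenspaceVanishing
import HarnessLib

/-!
# Level reduction of Fermat eigenspace algebraicity along the étale step `z ↦ zᵉ`, II: the middle degree and the orbit form (WEIL-2 gen 34, FERMAT-G33 §2 LEMMA L (ii)–(iii) in the kernel; fact-free)

research route, not a corollary; conditional on HC_CM plus one named minimal statement.

Cell `pub-hodge-ring2-ab-*` (ALL ABELIAN VARIETIES), seat WEIL-2 gen 34, account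
`run/shared/lean/pub/pub-hodge-ring2/pub-hodge-ring2-ab-weil-2/LEVEL-G34.md` §2.  Sequel of `Ring2AbelianAllFermatLevelReduction`
(equivariance `λ(g_a x) = g_{aᵉ}(λ x)`, `λ^* V_m(α) ⊆ V_{em}(e·α)`, surjectivity of `λ`, descent of algebraicity), which see for the geometry.

* §1 **middle degree, `n = 2r ≥ 2`**: `map_fermatEigenspace_eq_levelMul` — **`λ^* V_m(α) = V_{em}(e·α)`** for `α ≠ 0` (multiplicity one
  `dim V(β) ≤ 1`, Ran 1980 Prop. 1.7 (i), tree `fermatEigenspace_le_span_of_ne_zero`; non-vanishing `fermatEigenspace_ne_bot` for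
  admissible `α`; vanishing off `𝔄` transported by the bookkeeping `e·α = 0 ↔ α = 0`, `Σ e·αᵢ = 0 ↔ Σ αᵢ = 0`; injectivity of `λ^*`
  along the surjective equidimensional `λ`), whence the ascent half (`levelMul_le_algebraicClasses_of_fermatEigenspace`: pull-back of
  algebraic classes along the level map, `map_mem_algebraicClasses_of_fermatLevelMap`) and **LEMMA L (ii) as an `iff`**
  (`levelMul_le_algebraicClasses_iff`): `V_{em}(e·α)` algebraic ⟺ `V_m(α)` algebraic;
* §2 **LEMMA L (iii) + (ii) for the whole `(ℤ/·)ˣ`-orbit** (`orbit_levelMul_le_algebraicClasses_iff`): `t'·(eα) = e·(t̄'α)` coordinatewise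
  (`mul_levelMul_eq`), units reduce onto units (`ZMod.unitsMap_surjective`), so
  `(∀ t' ∈ (ℤ/em)ˣ, V_{em}(t'·eα) ⊆ alg) ↔ (∀ t ∈ (ℤ/m)ˣ, V_m(t·α) ⊆ alg)` — the statement «`α ∈ 𝔈_{em} ⟺ α/e ∈ 𝔈_m`» of
  FERMAT-G33 §2.1 for the geometric cycle-character predicate (span of algebraic classes, over `ℂ`), the bookkeeping identity behind
  THEOREM F_q♮ (e) and TABLE Q's column `e`;
* §3 worked instances (`decide`): the two `(H)`-violating (3,3) characters `[2,2,8,8,8,8] = 2·[1,1,4,4,4,4]`, `[4,4,4,4,10,10] =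
  2·[2,2,2,2,5,5]` of TABLE Q (ζ) flagged by ab-ref F-ab-182: their `(ℤ/12)ˣ`-orbits on `X⁴_12` are algebraic iff the `(ℤ/6)ˣ`-orbits of
  the reduced characters on `X⁴_6` are.

0 sorry, no `def`, no named fact; `HC_CM` does not occur.  Inputs beyond part I: `FermatEigenspace{MultiplicityOne,Nonvanishing,Vanishing}`
(Ran 1980 Prop. 1.7 (i); Shioda 1979 §1), PROVED tree files.
-/

noncomputable section

open CategoryTheory AlgebraicGeometry
open Literature.AlgebraicGeometry.Motives Literature.AlgebraicGeometry.HodgeTheory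
open Literature.AlgebraicTopology.SingularHomology Literature.NumberTheory.Transcendental
open Summit.HodgeConjecture.Ring2AbelianAll.FermatQuotientEtaleStep
open Summit.HodgeConjecture.Ring2AbelianAll.FermatLevelReduction

namespace Summit.HodgeConjecture.Ring2AbelianAll.FermatLevelReductionOrbit

variable {m e : ℕ}

/-! ### §1 Middle degree: `λ^* V_m(α) = V_{em}(e·α)`, and LEMMA L (ii) as an `iff` -/

/-- **`λ^* V_m(α) = V_{em}(e·α)` in the middle degree** `2r` of `X²ʳ` (`r ≥ 1`, `α ≠ 0`): `⊆` by part I §2; if `α` has a zero coordinate or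
`Σ αᵢ ≠ 0` both sides vanish (tree: `fermatEigenspace_eq_bot_of_apply_eq_zero`, `fermatEigenspace_eq_bot_of_sum_ne_zero`, transported by
part I §5's bookkeeping); otherwise `V_m(α) ≠ 0` (`fermatEigenspace_ne_bot`), `λ^*` is injective (`complexBetti_map_injective_of_surjective_of_dim_eq`)
and `dim V_{em}(e·α) ≤ 1` (`fermatEigenspace_le_span_of_ne_zero`), so the non-zero subspace `λ^* V_m(α)` fills the line.  This is
«`λ^* : V_{m′}(a′) ⥲ V_m(e a′)`» of FERMAT-G33 §2.1 (ii).  [locator FERMAT-G33 §2 LEMMA L (ii)]  [cite: Ran1980, §1 Prop. 1.7 (i)]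
research route, not a corollary; conditional on HC_CM plus one named minimal statement. -/
theorem map_fermatEigenspace_eq_levelMul {r : ℕ} (hr : 1 ≤ r) (he : 0 < e) (hm : 0 < m)
    {α : Fin (2 * r + 2) → ZMod m} (hα : α ≠ 0) {β : Fin (2 * r + 2) → ZMod (e * m)}
    (hβ : ∀ i, β i = ((e * (α i).val : ℕ) : ZMod (e * m))) :
    (fermatEigenspace m α (2 * r)).map (complexBetti.map (fermatLevelMap (2 * r) he hm) (2 * r)).hom =
      fermatEigenspace (e * m) β (2 * r) := by
  haveI : NeZero m := ⟨hm.ne'⟩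
  haveI : NeZero (e * m) := ⟨(Nat.mul_pos he hm).ne'⟩
  have hβ0 : β ≠ 0 := fun h ↦ hα ((levelMul_eq_zero_iff_fun he hm hβ).mp h)
  refine le_antisymm (map_fermatEigenspace_le_levelMul he hm hβ (2 * r)) ?_
  by_cases hzero : ∃ i, α i = 0
  · -- a zero coordinate: both sides vanish
    obtain ⟨i, hi⟩ := hzero
    have hβi : β i = 0 := by rw [hβ i, hi, ZMod.val_zero, mul_zero, Nat.cast_zero]
    rw [fermatEigenspace_eq_bot_of_apply_eq_zero (Nat.mul_pos he hm) hr hβ0 hβi]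
    exact bot_le
  push Not at hzero
  by_cases hsum : ∑ i, α i = 0
  · -- the admissible case: `V_m(α)` is a non-zero subspace of the line `V_{em}(β)`
    have hne : fermatEigenspace m α (2 * r) ≠ ⊥ := fermatEigenspace_ne_bot hr hzero hsum
    obtain ⟨v, hv⟩ := fermatEigenspace_le_span_of_ne_zero (NeZero.ne (e * m)) hr 0 hβ0
    haveI := surjective_fermatLevelMap (n := 2 * r) he hm
    have hinj := complexBetti_map_injective_of_surjective_of_dim_eq
      (isSmoothProjective_fermatHypersurface (n := 2 * r) (by omega) (Nat.mul_pos he hm))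
      (isSmoothProjective_fermatHypersurface (n := 2 * r) (by omega) hm) (fermatLevelMap (2 * r) he hm) (2 * r)
    have hne' : (fermatEigenspace m α (2 * r)).map (complexBetti.map (fermatLevelMap (2 * r) he hm) (2 * r)).hom ≠ ⊥ := by
      intro h
      apply hne
      rw [Submodule.eq_bot_iff] at h ⊢
      intro x hx
      exact hinj (by rw [map_zero]; exact h _ (Submodule.mem_map_of_mem hx))
    -- submodules of a line: a non-zero one is everything
    have hle : fermatEigenspace (e * m) β (2 * r) ≤ ℂ ∙ v := hv
    haveI : FiniteDimensional ℂ (ℂ ∙ v) := inferInstance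
    haveI : FiniteDimensional ℂ (fermatEigenspace (e * m) β (2 * r)) := Submodule.finiteDimensional_of_le hle
    have hv1 : Module.finrank ℂ (ℂ ∙ v) ≤ 1 := (finrank_span_le_card ({v} : Set _)).trans (by simp)
    have hfin : Module.finrank ℂ (fermatEigenspace (e * m) β (2 * r)) ≤ 1 := (Submodule.finrank_mono hle).trans hv1
    have hpos : 0 < Module.finrank ℂ
        ((fermatEigenspace m α (2 * r)).map (complexBetti.map (fermatLevelMap (2 * r) he hm) (2 * r)).hom) := by
      haveI : FiniteDimensional ℂ ((fermatEigenspace m α (2 * r)).map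
          (complexBetti.map (fermatLevelMap (2 * r) he hm) (2 * r)).hom) :=
        Submodule.finiteDimensional_of_le (map_fermatEigenspace_le_levelMul he hm hβ (2 * r))
      exact Module.finrank_pos_iff.mpr (Submodule.nontrivial_iff_ne_bot.mpr hne')
    exact (Submodule.eq_of_le_of_finrank_le (map_fermatEigenspace_le_levelMul he hm hβ (2 * r))
      (hfin.trans (Nat.succ_le_of_lt hpos))).symm.le
  · -- `Σ αᵢ ≠ 0`: both sides vanish
    have hsumβ : ∑ i, β i ≠ 0 := fun h ↦ hsum ((sum_levelMul_eq_zero_iff he hm hβ).mp h)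
    rw [fermatEigenspace_eq_bot_of_sum_ne_zero hsumβ]
    exact bot_le

/-- **LEMMA L (ii), ascent** (middle degree): if `V_m(α) ⊆ H²ʳ(X²ʳ_m(ℂ); ℂ)` consists of algebraic classes then so does
`V_{em}(e·α) = λ^* V_m(α)` (pull-back of algebraic classes along the level map is algebraic, `map_mem_algebraicClasses_of_fermatLevelMap`).
[locator FERMAT-G33 §2 LEMMA L (ii)]  research route, not a corollary; conditional on HC_CM plus one named minimal statement. -/
theorem levelMul_le_algebraicClasses_of_fermatEigenspace {r : ℕ} (hr : 1 ≤ r) (he : 0 < e) (hm : 0 < m)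
    {α : Fin (2 * r + 2) → ZMod m} (hα : α ≠ 0) {β : Fin (2 * r + 2) → ZMod (e * m)}
    (hβ : ∀ i, β i = ((e * (α i).val : ℕ) : ZMod (e * m)))
    (h : fermatEigenspace m α (2 * r) ≤ algebraicClasses (fermatHypersurface (2 * r) m) r) :
    fermatEigenspace (e * m) β (2 * r) ≤ algebraicClasses (fermatHypersurface (2 * r) (e * m)) r := by
  rw [← map_fermatEigenspace_eq_levelMul hr he hm hα hβ]
  rintro _ ⟨c, hc, rfl⟩
  exact map_mem_algebraicClasses_of_fermatLevelMap (n := 2 * r) (by omega) he hm (h hc)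

/-- **LEMMA L (ii) (FERMAT-G33 §2.1), kernel form, one character: `V_{em}(e·α)` is algebraic iff `V_m(α)` is** — for the Fermat varieties
`X²ʳ_{em} → X²ʳ_m` of even dimension `2r ≥ 2`, middle degree, `α ≠ 0`, `m, e ≥ 1`.  [locator FERMAT-G33 §2 LEMMA L (ii)]
research route, not a corollary; conditional on HC_CM plus one named minimal statement. -/
theorem levelMul_le_algebraicClasses_iff {r : ℕ} (hr : 1 ≤ r) (he : 0 < e) (hm : 0 < m)
    {α : Fin (2 * r + 2) → ZMod m} (hα : α ≠ 0) {β : Fin (2 * r + 2) → ZMod (e * m)}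
    (hβ : ∀ i, β i = ((e * (α i).val : ℕ) : ZMod (e * m))) :
    fermatEigenspace (e * m) β (2 * r) ≤ algebraicClasses (fermatHypersurface (2 * r) (e * m)) r ↔
      fermatEigenspace m α (2 * r) ≤ algebraicClasses (fermatHypersurface (2 * r) m) r :=
  ⟨fermatEigenspace_le_algebraicClasses_of_levelMul (n := 2 * r) (by omega) he hm hβ,
    levelMul_le_algebraicClasses_of_fermatEigenspace hr he hm hα hβ⟩

/-! ### §2 LEMMA L (iii) and the orbit form of LEMMA L (ii) -/

/-- **LEMMA L (ii)+(iii), orbit form (FERMAT-G33 §2.1): `⊕_{t' ∈ (ℤ/em)ˣ} V_{em}(t'·eα)` is algebraic iff `⊕_{t ∈ (ℤ/m)ˣ} V_m(t·α)` is.**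
For the Fermat varieties of even dimension `2r ≥ 2`, middle degree, `α ≠ 0`, `m, e ≥ 1`: the `(ℤ/em)ˣ`-orbit of the level-raised character
`e·α` is the level-raise of the `(ℤ/m)ˣ`-orbit of `α` (`mul_levelMul_eq`; reduction of units is onto, `ZMod.unitsMap_surjective`), and each
member is algebraic iff its reduction is (`levelMul_le_algebraicClasses_iff`).  In the cell's notation: «`α ∈ 𝔈_{em} ⟺ α/e ∈ 𝔈_m`» for
the GEOMETRIC cycle-character predicate `𝔈` (span of algebraic classes, over `ℂ`) — the bookkeeping identity behind THEOREM F_q♮ (e) and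
TABLE Q's column `e`.  [locator FERMAT-G33 §2 LEMMA L (ii)–(iii), THEOREM F_q♮ (e)]  [cite: Ran1980, §1 Prop. 1.7 (i)]
research route, not a corollary; conditional on HC_CM plus one named minimal statement. -/
theorem orbit_levelMul_le_algebraicClasses_iff {r : ℕ} (hr : 1 ≤ r) (he : 0 < e) (hm : 0 < m)
    {α : Fin (2 * r + 2) → ZMod m} (hα : α ≠ 0) {β : Fin (2 * r + 2) → ZMod (e * m)}
    (hβ : ∀ i, β i = ((e * (α i).val : ℕ) : ZMod (e * m))) :
    (∀ t' : (ZMod (e * m))ˣ, fermatEigenspace (e * m) (fun i ↦ (t' : ZMod (e * m)) * β i) (2 * r) ≤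
        algebraicClasses (fermatHypersurface (2 * r) (e * m)) r) ↔
      (∀ t : (ZMod m)ˣ, fermatEigenspace m (fun i ↦ (t : ZMod m) * α i) (2 * r) ≤
        algebraicClasses (fermatHypersurface (2 * r) m) r) := by
  haveI : NeZero m := ⟨hm.ne'⟩
  haveI : NeZero (e * m) := ⟨(Nat.mul_pos he hm).ne'⟩
  have hdvd : m ∣ e * m := Dvd.intro_left e rfl
  -- the orbit of `β` is the level-raise of the orbit of `α`
  have horb : ∀ t' : (ZMod (e * m))ˣ, ∀ i, (t' : ZMod (e * m)) * β i =
      ((e * (((ZMod.unitsMap hdvd t' : (ZMod m)ˣ) : ZMod m) * α i).val : ℕ) : ZMod (e * m)) := fun t' i ↦ by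
    rw [hβ i, mul_levelMul_eq he hm, ZMod.unitsMap_val]
  -- unit multiples of `α ≠ 0` are `≠ 0`
  have hne : ∀ t : (ZMod m)ˣ, (fun i ↦ (t : ZMod m) * α i) ≠ 0 := by
    intro t h
    apply hα
    funext i
    have hi := congrFun h i
    simp only [Pi.zero_apply] at hi
    simpa using congrArg (fun x ↦ ((t⁻¹ : (ZMod m)ˣ) : ZMod m) * x) hi
  constructor
  · intro h t
    obtain ⟨t', rfl⟩ := ZMod.unitsMap_surjective hdvd t
    exact (levelMul_le_algebraicClasses_iff hr he hm (hne _) (horb t')).mp (h t')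
  · intro h t'
    exact (levelMul_le_algebraicClasses_iff hr he hm (hne _) (horb t')).mpr (h _)

/-! ### §3 Worked instances: the two `(H)`-violating (3,3) characters of TABLE Q flagged by F-ab-182 -/

/-- The X-data `[2,2,8,8,8,8]` mod `12` of the NEW (3,3) habitat type of TABLE Q (ζ) with `e = 2` (ℚ(√−3), `ℤ/12 ⋊ ⟨7⟩`, elliptic base) IS the
level-raise of `[1,1,4,4,4,4]` mod `6`, coordinatewise (companion of `FermatQuotientEtaleStep.map_levelMul_two_1_1_4_4_4_4`, multiset form).
[locator FERMAT-G33 §3 TABLE Q column e]  research route, not a corollary; conditional on HC_CM plus one named minimal statement. -/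
theorem levelMul_two_1_1_4_4_4_4 :
    ∀ i : Fin (2 * 2 + 2), (![2, 2, 8, 8, 8, 8] : Fin (2 * 2 + 2) → ZMod (2 * 6)) i =
      ((2 * ((![1, 1, 4, 4, 4, 4] : Fin (2 * 2 + 2) → ZMod 6) i).val : ℕ) : ZMod (2 * 6)) := by
  decide

/-- **TABLE Q's `e = 2` bookkeeping, kernel-closed for the type `[2,2,8,8,8,8]`**: the `(ℤ/12)ˣ`-orbit of eigenlines `V_12(t'·(2,2,8,8,8,8))`
of the Fermat FOURFOLD of degree `12` consists of algebraic classes iff the `(ℤ/6)ˣ`-orbit `V_6(t·(1,1,4,4,4,4))` of the Fermat fourfold of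
degree `6` does (`orbit_levelMul_le_algebraicClasses_iff` at `m = 6`, `e = 2`, `r = 2`) — the Fermat input of THEOREM F_1♮ (e) for this
habitat may be taken at level `6`, where it is Shioda's `(P_6)` / the semi-decomposition `[1,1,4 | 4,4,4]`.
[locator FERMAT-G33 §2 THEOREM F_q♮ (e), §3]  research route, not a corollary; conditional on HC_CM plus one named minimal statement. -/
theorem orbit_le_algebraicClasses_iff_2_2_8_8_8_8 :
    (∀ t' : (ZMod (2 * 6))ˣ, fermatEigenspace (2 * 6)
        (fun i ↦ (t' : ZMod (2 * 6)) * (![2, 2, 8, 8, 8, 8] : Fin (2 * 2 + 2) → ZMod (2 * 6)) i) (2 * 2) ≤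
        algebraicClasses (fermatHypersurface (2 * 2) (2 * 6)) 2) ↔
      (∀ t : (ZMod 6)ˣ, fermatEigenspace 6
        (fun i ↦ (t : ZMod 6) * (![1, 1, 4, 4, 4, 4] : Fin (2 * 2 + 2) → ZMod 6) i) (2 * 2) ≤
        algebraicClasses (fermatHypersurface (2 * 2) 6) 2) :=
  orbit_levelMul_le_algebraicClasses_iff (r := 2) (by norm_num) (by norm_num) (by norm_num) (by decide)
    levelMul_two_1_1_4_4_4_4

/-- The X-data `[4,4,4,4,10,10]` mod `12` of the second `e = 2` NEW (3,3) type of TABLE Q (ζ) is the level-raise of `[2,2,2,2,5,5]` mod `6`,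
coordinatewise.  [locator FERMAT-G33 §3 TABLE Q column e]  research route, not a corollary; conditional on HC_CM plus one named minimal statement. -/
theorem levelMul_two_2_2_2_2_5_5 :
    ∀ i : Fin (2 * 2 + 2), (![4, 4, 4, 4, 10, 10] : Fin (2 * 2 + 2) → ZMod (2 * 6)) i =
      ((2 * ((![2, 2, 2, 2, 5, 5] : Fin (2 * 2 + 2) → ZMod 6) i).val : ℕ) : ZMod (2 * 6)) := by
  decide

/-- **The same for the type `[4,4,4,4,10,10]`**: its `(ℤ/12)ˣ`-orbit of eigenlines on `X⁴_12` is algebraic iff the `(ℤ/6)ˣ`-orbit of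
`V_6(t·(2,2,2,2,5,5))` on `X⁴_6` is (there: `(P_6)` / the quasi-decomposition of `{5,5,2,2,2,2}`).
[locator FERMAT-G33 §2 THEOREM F_q♮ (e), §3]  research route, not a corollary; conditional on HC_CM plus one named minimal statement. -/
theorem orbit_le_algebraicClasses_iff_4_4_4_4_10_10 :
    (∀ t' : (ZMod (2 * 6))ˣ, fermatEigenspace (2 * 6)
        (fun i ↦ (t' : ZMod (2 * 6)) * (![4, 4, 4, 4, 10, 10] : Fin (2 * 2 + 2) → ZMod (2 * 6)) i) (2 * 2) ≤
        algebraicClasses (fermatHypersurface (2 * 2) (2 * 6)) 2) ↔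
      (∀ t : (ZMod 6)ˣ, fermatEigenspace 6
        (fun i ↦ (t : ZMod 6) * (![2, 2, 2, 2, 5, 5] : Fin (2 * 2 + 2) → ZMod 6) i) (2 * 2) ≤
        algebraicClasses (fermatHypersurface (2 * 2) 6) 2) :=
  orbit_levelMul_le_algebraicClasses_iff (r := 2) (by norm_num) (by norm_num) (by norm_num) (by decide)
    levelMul_two_2_2_2_2_5_5

end Summit.HodgeConjecture.Ring2AbelianAll.FermatLevelReductionOrbit

end
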